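import Mathlib
import HarnessLib
import Summits.NavierStokesRegularity.FluidComputer.PalasekTowerRescaledCopyTolerance

/-!
# REGISTER v2.5: the rescaled-copy alphabet at a general tolerance `δ` and a general onset level

Cell `ns-blowup`; drafted by the line owner `ns-blowup-fc-route` (g2, `lines/port/PalasekTowerRescaledCopyDelta.lean`
425ef9179acbc00d, ns-blowup STATUS l.3278 / l.3306) and filed by the prover seat `ns-blowup-fc-prover-2` (g4),
RE-HOMED onto `PalasekTowerRescaledCopyTolerance.lean` (p438890, same seat: `CaptureAtδ k δ` — identical
definition and name, so it is imported, not re-declared —, `Captureδ δ`, `Renormaliseδ δin δout`,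
`CaptureAtδ.mono`, `CaptureAtδ.succ`); fifth module of the series `PalasekTowerRescaledCopy.lean` (p422042:
`RescaledCopy`, `Runs`, `Letter`, the open statements `Capture` / `CaptureAt k` / `Renormalise` /
`FirstGateCopy` at the fixed tolerance `2/3`), `PalasekTowerRescaledCopyHeredity.lean` (p422280),
`PalasekTowerRescaledCopyAtoms.lean` and `PalasekTowerRescaledCopyTolerance.lean` (p438890). LABEL: E–C typing (KERNEL bookkeeping; every implication proved; open
statements appear only as named `@[conjecture]` Props, as hypotheses, or inside equivalences).
WHAT THIS IS NOT: not Navier–Stokes evidence — no stage, letter, tower or instance is constructed or asserted;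
nothing here proves or refutes a stub of any line; MODEL words never enter.

## Why

refuter4's audit K58 of the line `fc-oneshot` (crux `EpisodeInduction`, item stmt-NavierStokesRegularity-19178)
found two CALIBRATION defects in the tolerance-`2/3` vocabulary: (i) `2/3` is not a discriminating tolerance for
the copy relation (so, given `Capture`, `Renormalise ↔ HeredityFrom 2` makes the gate stub the N1 child in copy
vocabulary), and (ii) the seed `CaptureAt 2` compares the PREPARED level-`1` letter with the first AUTONOMOUS
letter, a fragile `∀` specific to `k = 2`. Both repairs are re-parametrisations: a tolerance parameter `δ` and an
onset parameter `k₀`. This module supplies the three parametrised statements and their sorry-free bookkeeping, so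
that a line can be stated at any `(k₀, δ)` over TREE names:

* §1 (`CaptureAtδ k δ` is imported: the tree's `CaptureAt k` is `δ = 2/3`), `GateCopyAt k δ` (a gate WITH copy
  output at level `k`; `FirstGateCopy` is `k = 1, δ = 2/3`), `RenormaliseFrom k₀ δ` (the robust gate from level
  `k₀`; `Renormalise` is `k₀ = 2, δ = 2/3`, and `Renormaliseδ δ δ` of p438890 is `k₀ = 2`) — §2 records the
  `Iff.rfl` dictionary entries and the level-monotonicity of the onset;
* §3 API: monotonicity in `δ`; a gate with copy output contains heredity at its level and SEEDS capture one
  level up (`GateCopyAt.captureAtδ_succ`, levels `k ≥ 2`, silent-window uniqueness, no named fact); the gate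
  PROPAGATES capture (`CaptureAtδ.succ_of_renormaliseFrom`, = `CaptureAt.succ` at general `δ, k₀`); capture +
  gate give heredity at the level (`Stage.exists_extends_iff_runs_letter`);
* §4 composition at a general onset: a prefix of plain gates `HeredityAt j` (`1 ≤ j < k₀`), a seeded gate
  `GateCopyAt k₀ δ` and the robust gate `RenormaliseFrom (k₀+1) δ` close K2G `EpisodeInductionG` (`k₀ ≥ 2`);
* §5 LOSSLESSNESS modulo alphabet closure, at general `(k₀, δ)`: `GateCopyAt k₀ δ ∧ RenormaliseFrom (k₀+1) δ ↔
  HeredityFrom k₀ ∧ ∀ k ≥ k₀+1, CaptureAtδ k δ` — the information such a line carries beyond the N1 child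
  `HeredityFrom k₀` is EXACTLY the constraint atom «alphabet closure from level `k₀+1` at tolerance `δ`»;
* §6 the `(k₀, δ) = (2, 1/3)` instance used by the line's v2.5 design: `HeredityAtOne → GateCopyAt 2 (1/3) →
  RenormaliseFrom 3 (1/3) → EpisodeInductionG`, and `GateCopyAt 2 (1/3) → RenormaliseFrom 3 (1/3) → HeredityFrom 2`.
-/

noncomputable section

namespace Summit.NavierStokesRegularity.FluidComputer.PalasekTowerClayBridge

open Set

/-! ## §1 The parametrised statements -/

/-- **Gate with copy output at level `k`, tolerance `δ`**: every registered level-`k` stage extends to a registered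
level-`(k+1)` stage whose `τ (k+1)`-letter is a `δ`-copy of the level-`k` letter. `FirstGateCopy` is the case
`k = 1`, `δ = 2/3`. INTENDED RANGE `k ≥ 1` (absolute tolerance `δ · Y_(k+1)`); used below at `k = k₀ ≥ 2`. [folklore] -/
@[conjecture] def GateCopyAt (k : ℕ) (δ : ℝ) : Prop :=
  ∀ S : Schedule TowerRates.wide, S.Pins 8 (6 / 5) → S.Rigid → S.Quiet →
    ∀ s : Stage 1 TowerRates.wide S (Margins.routeG TowerRates.wide) k,
      ∃ s' : Stage 1 TowerRates.wide S (Margins.routeG TowerRates.wide) (k + 1),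
        s.Extends s' ∧ RescaledCopy S k (k + 1) (s.u (S.τ k)) (s'.u (S.τ (k + 1))) δ

/-- **The robust one-shot gate from level `k₀` on, tolerance `δ`**: a registered level-`k` letter (`k ≥ k₀`) that
is a `δ`-copy of its predecessor runs, unforced over the rigid window, to a continuation inside the next ceiling
whose field at `τ (k+1)` is a level-`(k+1)` letter AND a `δ`-rescaled copy of the level-`k` letter. `Renormalise`
is the case `k₀ = 2`, `δ = 2/3`. INTENDED RANGE `k₀ ≥ 2` (at `k₀ ≤ 1` the `k = 0/1` instances carry the ℕ-subtraction
junk of `CaptureAtδ`'s docstring as a HYPOTHESIS); every composition below assumes `2 ≤ k₀` or uses `k₀ = 3`. [folklore] -/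
@[conjecture] def RenormaliseFrom (k₀ : ℕ) (δ : ℝ) : Prop :=
  ∀ S : Schedule TowerRates.wide, S.Pins 8 (6 / 5) → S.Rigid → S.Quiet → ∀ k : ℕ, k₀ ≤ k →
    ∀ s : Stage 1 TowerRates.wide S (Margins.routeG TowerRates.wide) k,
      RescaledCopy S (k - 1) k (s.u (S.τ (k - 1))) (s.u (S.τ k)) δ →
      ∃ (u : ℝ → EuclideanSpace ℝ (Fin 3) → EuclideanSpace ℝ (Fin 3))
        (p : ℝ → EuclideanSpace ℝ (Fin 3) → ℝ),
        Runs S k s u p ∧ Letter S (k + 1) (u (S.τ (k + 1))) ∧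
        RescaledCopy S k (k + 1) (s.u (S.τ k)) (u (S.τ (k + 1))) δ

/-! ## §2 Dictionary with the tolerance-`2/3` names (definitional) -/

/-- `CaptureAt k` is `CaptureAtδ k (2/3)`. [folklore] -/
theorem captureAt_iff_captureAtδ (k : ℕ) : CaptureAt k ↔ CaptureAtδ k (2 / 3) := Iff.rfl

/-- `FirstGateCopy` is `GateCopyAt 1 (2/3)`. [folklore] -/
theorem firstGateCopy_iff_gateCopyAt_one : FirstGateCopy ↔ GateCopyAt 1 (2 / 3) := Iff.rfl

/-- `Renormalise` is `RenormaliseFrom 2 (2/3)`. [folklore] -/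
theorem renormalise_iff_renormaliseFrom_two : Renormalise ↔ RenormaliseFrom 2 (2 / 3) := Iff.rfl

/-- The tolerance-preserving gate `Renormaliseδ δ δ` (p438890) is `RenormaliseFrom 2 δ`. [folklore] -/
theorem renormaliseδ_iff_renormaliseFrom_two (δ : ℝ) : Renormaliseδ δ δ ↔ RenormaliseFrom 2 δ := Iff.rfl

/-- The onset of the robust gate can be RAISED: a gate from level `k₀` is a gate from every later level.
[folklore] -/
theorem RenormaliseFrom.of_le {k₀ k₁ : ℕ} {δ : ℝ} (h : RenormaliseFrom k₀ δ) (hk : k₀ ≤ k₁) :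
    RenormaliseFrom k₁ δ :=
  fun S hP hR hQ k hk₁ s hc => h S hP hR hQ k (hk.trans hk₁) s hc

/-- A two-tolerance gate `Renormaliseδ δin δout` with `δ ≤ δin` and `δout ≤ δ` is a gate from every onset
`k₀ ≥ 2` at tolerance `δ`. [folklore] -/
theorem Renormaliseδ.renormaliseFrom {δin δout δ : ℝ} {k₀ : ℕ} (h : Renormaliseδ δin δout) (hin : δ ≤ δin)
    (hout : δout ≤ δ) (hk₀ : 2 ≤ k₀) : RenormaliseFrom k₀ δ :=
  ((renormaliseδ_iff_renormaliseFrom_two δ).1 (h.mono hin hout)).of_le hk₀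

/-! ## §3 API -/

/-- A gate with copy output is monotone in the tolerance. [folklore] -/
theorem GateCopyAt.mono {k : ℕ} {δ δ' : ℝ} (h : GateCopyAt k δ) (hδ : δ ≤ δ') : GateCopyAt k δ' :=
  fun S hP hR hQ s => by
    obtain ⟨s', hs', hc⟩ := h S hP hR hQ s
    exact ⟨s', hs', hc.mono hδ⟩

/-- A gate with copy output at level `k` contains heredity at level `k` (drop the copy clause). [folklore] -/
theorem GateCopyAt.heredityAt {k : ℕ} {δ : ℝ} (h : GateCopyAt k δ) : HeredityAt k :=
  fun S hP hR hQ s => by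
    obtain ⟨s', hs', -⟩ := h S hP hR hQ s
    exact ⟨s', hs'⟩

/-- **A seeded alphabet is a clause of every later stage** (levels `k ≥ 2`): a registered level-`(k+1)` stage
restricts to level `k` (`Stage.restrictOfAntitone`); the gate with copy output extends the restriction to SOME
level-`(k+1)` stage whose letter is a copy; the two level-`(k+1)` stages carry the same velocity on
`[0, τ (k+1)]` by silent-window uniqueness (`Stage.extends_velocity_eq`: quiet schedule, `k ≥ 2`; no named fact).
[cite: Tao2011, Cor. 11.4] -/
theorem GateCopyAt.captureAtδ_succ {k : ℕ} {δ : ℝ} (h : GateCopyAt k δ) (hk : 2 ≤ k) : CaptureAtδ (k + 1) δ := by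
  intro S hP hRig hQ s
  let s₀ : Stage 1 TowerRates.wide S (Margins.routeG TowerRates.wide) k :=
    s.restrictOfAntitone (Margins.antitone_routeG TowerRates.wide) (Nat.le_succ k)
  obtain ⟨s', hs', hc⟩ := h S hP hRig hQ s₀
  have heq : ∀ t ∈ Icc 0 (S.τ (k + 1)), s.u t = s'.u t :=
    s₀.extends_velocity_eq one_pos hQ hk s s' (fun _ _ => rfl) (fun t ht => (hs' t ht).1)
  rw [Nat.add_sub_cancel, heq (S.τ (k + 1)) ⟨(S.τ_pos _).le, le_rfl⟩]
  exact hc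

/-- **Propagation by the gate** (`CaptureAt.succ` at general tolerance and onset): given the gate from level
`k₀` at tolerance `δ`, capture at a level `k ≥ max k₀ 2` implies capture at `k + 1` — restriction, the gate's
continuation, and `Stage.continuation_velocity_eq`. [cite: Tao2011, Cor. 11.4] -/
theorem CaptureAtδ.succ_of_renormaliseFrom {k₀ k : ℕ} {δ : ℝ} (h : CaptureAtδ k δ) (hR : RenormaliseFrom k₀ δ)
    (hk₀ : k₀ ≤ k) (hk : 2 ≤ k) : CaptureAtδ (k + 1) δ := by
  intro S hP hRig hQ s
  let s₀ : Stage 1 TowerRates.wide S (Margins.routeG TowerRates.wide) k :=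
    s.restrictOfAntitone (Margins.antitone_routeG TowerRates.wide) (Nat.le_succ k)
  obtain ⟨u, p, ⟨hcl, hagree, henergy, -⟩, -, hcopy⟩ := hR S hP hRig hQ k hk₀ s₀ (h S hP hRig hQ s₀)
  have heq : ∀ t ∈ Icc 0 (S.τ (k + 1)), u t = s.u t :=
    s₀.continuation_velocity_eq one_pos hQ hk (S.τ_mono (Nat.le_succ k)) hcl s.classical
      (fun t ht => (hagree t ht).1) (fun _ _ => rfl) henergy s.energy
  rw [Nat.add_sub_cancel, ← heq (S.τ (k + 1)) ⟨(S.τ_pos _).le, le_rfl⟩]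
  exact hcopy

/-- **Heredity at a captured level from the gate**: the gate's continuation RUNS and carries the next LETTER, hence
is an extension stage (`Stage.exists_extends_iff_runs_letter`). [folklore] -/
theorem heredityAt_of_captureAtδ_renormaliseFrom {k₀ k : ℕ} {δ : ℝ} (h : CaptureAtδ k δ)
    (hR : RenormaliseFrom k₀ δ) (hk₀ : k₀ ≤ k) : HeredityAt k := by
  intro S hP hRig hQ s
  obtain ⟨u, p, hruns, hletter, -⟩ := hR S hP hRig hQ k hk₀ s (h S hP hRig hQ s)
  exact (Stage.exists_extends_iff_runs_letter s).2 ⟨u, p, hruns, hletter⟩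

/-- Capture at every level `k ≥ k₀ + 1` from a seeded gate at `(k₀, k₀+1)`, `k₀ ≥ 2`, and the robust gate from
level `k₀ + 1`. [cite: Tao2011, Cor. 11.4] -/
theorem captureAtδ_of_gateCopyAt_renormaliseFrom {k₀ : ℕ} {δ : ℝ} (hk₀ : 2 ≤ k₀) (hG : GateCopyAt k₀ δ)
    (hR : RenormaliseFrom (k₀ + 1) δ) {k : ℕ} (hk : k₀ + 1 ≤ k) : CaptureAtδ k δ := by
  induction k, hk using Nat.le_induction with
  | base => exact hG.captureAtδ_succ hk₀
  | succ k hle ih => exact ih.succ_of_renormaliseFrom hR hle (by omega)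

/-- Heredity from the seed level `k₀ ≥ 2` on, from the seeded gate and the robust gate. [cite: Tao2011, Cor. 11.4] -/
theorem heredityFrom_of_gateCopyAt_renormaliseFrom {k₀ : ℕ} {δ : ℝ} (hk₀ : 2 ≤ k₀) (hG : GateCopyAt k₀ δ)
    (hR : RenormaliseFrom (k₀ + 1) δ) : HeredityFrom k₀ :=
  hG.heredityAt.heredityFrom fun S hP hRig hQ _k hk s =>
    heredityAt_of_captureAtδ_renormaliseFrom (captureAtδ_of_gateCopyAt_renormaliseFrom hk₀ hG hR hk) hR hk
      S hP hRig hQ s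

/-! ## §4 Composition at a general onset -/

/-- **K2G from a prefix of plain gates, a seeded gate at `(k₀, k₀+1)` and the robust gate from `k₀ + 1`**
(`k₀ ≥ 2`; the prefix levels `1 ≤ j < k₀` are instances of the N1 children `HeredityAtOne` / `HeredityFrom 2`).
[cite: Tao2011, Cor. 11.4] -/
theorem episodeInductionG_of_prefix_gateCopyAt_renormaliseFrom {k₀ : ℕ} {δ : ℝ} (hk₀ : 2 ≤ k₀)
    (hpre : ∀ j : ℕ, 1 ≤ j → j < k₀ → HeredityAt j) (hG : GateCopyAt k₀ δ) (hR : RenormaliseFrom (k₀ + 1) δ) :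
    EpisodeInductionG := by
  have hk₀' : HeredityFrom k₀ := heredityFrom_of_gateCopyAt_renormaliseFrom hk₀ hG hR
  have hdown : ∀ d j : ℕ, j + d = k₀ → 1 ≤ j → HeredityFrom j := by
    intro d
    induction d with
    | zero => intro j hj _; rw [Nat.add_zero] at hj; exact hj ▸ hk₀'
    | succ d ih =>
      intro j hj hj1
      exact (hpre j hj1 (by omega)).heredityFrom (ih (j + 1) (by omega) (by omega))
  exact episodeInductionG_iff_heredityFrom_one.2 (hdown (k₀ - 1) 1 (by omega) le_rfl)

/-! ## §5 Losslessness modulo alphabet closure, at general `(k₀, δ)` -/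

/-- Heredity at level `k` plus capture at level `k + 1` give the gate WITH copy output at level `k`: the extension's
`τ (k+1)`-letter is a copy of ITS OWN `τ k`-letter, which is the stage's. [folklore] -/
theorem GateCopyAt.of_heredityAt_captureAtδ {k : ℕ} {δ : ℝ} (h : HeredityAt k) (hC : CaptureAtδ (k + 1) δ) :
    GateCopyAt k δ := by
  intro S hP hRig hQ s
  obtain ⟨s', hs'⟩ := h S hP hRig hQ s
  refine ⟨s', hs', ?_⟩
  have hc := hC S hP hRig hQ s'
  rw [Nat.add_sub_cancel, (hs' (S.τ k) ⟨(S.τ_pos k).le, le_rfl⟩).1] at hc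
  exact hc

/-- Heredity from level `k₀` plus capture at every level `≥ k₀ + 1` give the robust gate from `k₀` (its copy
HYPOTHESIS is then not even used: `Runs.of_extends`, `Letter.of_stage`, and the copy clause of the extension).
[folklore] -/
theorem RenormaliseFrom.of_heredityFrom_captureAtδ {k₀ : ℕ} {δ : ℝ} (h : HeredityFrom k₀)
    (hC : ∀ k : ℕ, k₀ + 1 ≤ k → CaptureAtδ k δ) : RenormaliseFrom k₀ δ := by
  intro S hP hRig hQ k hk s _
  obtain ⟨s', hs'⟩ := h S hP hRig hQ k hk s
  refine ⟨s'.u, s'.p, Runs.of_extends s s' hs', Letter.of_stage s' le_rfl, ?_⟩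
  have hc := hC (k + 1) (by omega) S hP hRig hQ s'
  rw [Nat.add_sub_cancel, (hs' (S.τ k) ⟨(S.τ_pos k).le, le_rfl⟩).1] at hc
  exact hc

/-- **LOSSLESSNESS at general onset and tolerance**: for `k₀ ≥ 2`, the pair «seeded gate at `(k₀, k₀+1)` + robust
gate from `k₀ + 1`» is EQUIVALENT to «heredity from `k₀` (the N1 child) + alphabet closure from level `k₀ + 1` at
tolerance `δ`». What such a line asserts beyond the N1 split is exactly the constraint atom on the right.
[cite: Tao2011, Cor. 11.4] -/
theorem gateCopyAt_and_renormaliseFrom_iff {k₀ : ℕ} {δ : ℝ} (hk₀ : 2 ≤ k₀) :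
    GateCopyAt k₀ δ ∧ RenormaliseFrom (k₀ + 1) δ ↔ HeredityFrom k₀ ∧ ∀ k : ℕ, k₀ + 1 ≤ k → CaptureAtδ k δ := by
  constructor
  · rintro ⟨hG, hR⟩
    exact ⟨heredityFrom_of_gateCopyAt_renormaliseFrom hk₀ hG hR,
      fun k hk => captureAtδ_of_gateCopyAt_renormaliseFrom hk₀ hG hR hk⟩
  · rintro ⟨hH, hC⟩
    have hH' : HeredityFrom (k₀ + 1) := ((heredityFrom_iff k₀).1 hH).2
    exact ⟨GateCopyAt.of_heredityAt_captureAtδ ((heredityFrom_iff k₀).1 hH).1 (hC (k₀ + 1) le_rfl),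
      RenormaliseFrom.of_heredityFrom_captureAtδ hH' fun k hk => hC k (by omega)⟩

/-! ## §6 The instance `(k₀, δ) = (2, 1/3)` of the line's v2.5 design -/

/-- **Heredity from level 2 (the N1 child `HeredityFrom 2`, item -19250) from the v2.5 pair.**
[cite: Tao2011, Cor. 11.4] -/
theorem heredityFrom_two_of_gateCopyAt_two_renormaliseFrom_three {δ : ℝ} (hG : GateCopyAt 2 δ)
    (hR : RenormaliseFrom 3 δ) : HeredityFrom 2 :=
  heredityFrom_of_gateCopyAt_renormaliseFrom le_rfl hG hR

/-- **The v2.5 cut closes K2G**: first gate (`HeredityAtOne`, item -19249), seeded second gate, robust gate from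
level 3. [cite: Tao2011, Cor. 11.4] -/
theorem episodeInductionG_of_heredityAtOne_gateCopyAt_two_renormaliseFrom_three {δ : ℝ} (h₁ : HeredityAtOne)
    (hG : GateCopyAt 2 δ) (hR : RenormaliseFrom 3 δ) : EpisodeInductionG :=
  episodeInductionG_iff_heredityFrom_one.2
    ((heredityAtOne_iff.1 h₁).heredityFrom (heredityFrom_two_of_gateCopyAt_two_renormaliseFrom_three hG hR))

/-- By monotonicity the `δ = 1/3` pair yields the tree's `2/3`-capture at every level `k ≥ 3`. [folklore] -/
theorem captureAt_of_gateCopyAt_two_renormaliseFrom_three_third (hG : GateCopyAt 2 (1 / 3))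
    (hR : RenormaliseFrom 3 (1 / 3)) {k : ℕ} (hk : 3 ≤ k) : CaptureAt k :=
  (captureAt_iff_captureAtδ k).2 ((captureAtδ_of_gateCopyAt_renormaliseFrom le_rfl hG hR hk).mono (by norm_num))

end Summit.NavierStokesRegularity.FluidComputer.PalasekTowerClayBridge

end
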